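/-
Origin: expansion seat `planner-pub-hodgecm-qw8-g11-0`, handover #13 SPLIT PART 2/2 = REPLACE tree `HodgeCM/Model/Toy/LefPartialConjGalois.lean` 467526c6 (659 l.) by md5 0a61f6b188fa6618d1833a6f916711ea (335 l.): keeps the module name + module docstring, its earlier sections moved verbatim to rows #12..#12 (LefGalClosure); ONE rewrite: `import Qw8g11.LefGalClosure` -> `import HodgeCM.Model.Toy.LefGalClosure` (row #12); union of the parts' comment-stripped code  (`HOME/pub-hodgecm-qw8-g11/lean/Qw8g11/LefPartialConjGalois.lean`, md5 0a61f6b1, 335 lines);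
landed by the packager successor (mc-unitary-1-g3, gen-8 kit) in gate run 32 REPLACES the earlier landed copy of `HodgeCM/Model/Toy/LefPartialConjGalois.lean` (import ^import Qw8g11\.LefGalClosure[ \t]*$→import HodgeCM.Model.Toy.LefGalClosure ×1).
-/
-- HANDOVER (planner-pub-hodgecm-qw8-g11-0, unit pub-hodgecm-qw8-g11): SPLIT PART 2/2 = REPLACEMENT of the installed
-- `HodgeCM.Model.Toy.LefPartialConjGalois` (md5 467526c6, 659 l.): §§6–8 (ll. 401–655) verbatim + docstrings; §§1–5 moved to
-- `LefGalClosure`; at landing rewrite `import Qw8g11.LefGalClosure` ↦ `import HodgeCM.Model.Toy.LefGalClosure` (lands AFTER it).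
/-
Copyright (c) 2026. All rights reserved.
Released under Apache 2.0 license as described in the file LICENSE.
-/
import Summits.HodgeConjecture.HodgeCM.Model.Toy.LefGalClosure

/-!
# Partial complex conjugations: the Galois criterion

(Split for the 400-line cap: §§1–5 of this file — `ℚ̄/ℚ`, `galClosure`, the criterion `partialConj_iff`, its first
consequences and the quadratic case — are now the module `HodgeCM.Model.Toy.LefGalClosure`, imported here; §§6–8
below are unchanged.)

`LefPartialConj` mixes two CM fields `K₁, K₂` of degree `≤ 4` in the Lefschetz model under the HYPOTHESIS
`PartialConj K₁ K₂` (some `γ ∈ Aut_ℚ(ℚ̄)` is complex conjugation on every embedding `K₁ → ℂ` and the identity on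
every embedding `K₂ → ℂ`), whose existence was left open there.  Here that hypothesis is DISCHARGED into plain
field theory inside `ℚ̄ ⊂ ℂ`:

* `galClosure K ⊆ ℚ̄` is the Galois closure of a number field `K` (the compositum of all its complex embeddings,
  Mathlib's `IntermediateField.normalClosure ℚ K ℚ̄`); `γ` fixes every embedding of `K` iff `γ` fixes `galClosure K`
  pointwise (`mem_fixingSubgroup_galClosure_iff`), and conjugates every embedding iff `κ⁻¹γ` does (`…_iff_conj`).
* **Criterion** (`partialConj_iff`): `PartialConj K₁ K₂ ↔` complex conjugation `κ` fixes
  `galClosure K₁ ⊓ galClosure K₂` pointwise, i.e. the two Galois closures meet in a REAL field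
  (`partialConj_iff_conj_eq`).  Proof: `PartialConj K₁ K₂ ↔ κ ∈ H₁H₂` for the pointwise stabilisers `Hᵢ ⊴ Aut_ℚ(ℚ̄)`
  of the closures (`partialConj_iff_mem_sup`), and `H₁ ⊔ H₂` is the (open, hence closed) subgroup belonging to
  `galClosure K₁ ⊓ galClosure K₂` under the Krull–Galois correspondence of `ℚ̄/ℚ` (`fixingSubgroup_inf_eq_sup`,
  from Mathlib's `InfiniteGalois.fixingSubgroup_fixedField`).
* Consequences: closures meeting in `ℚ` (`partialConj_of_inf_eq_bot`) or in a field of ODD degree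
  (`partialConj_of_odd_finrank`) give a partial conjugation; an embedding of `K₂` taking a non-real value inside
  `galClosure K₁` forbids one (`not_partialConj_of_mem_galClosure`; in particular `galClosure K₂ ≤ galClosure K₁`
  for `K₂` carrying a CM type, `not_partialConj_of_galClosure_le` — the reflex-sister obstruction noted in `LefPartialConj` —
  and `K₂ ↪ K₁`, `not_partialConj_of_ringHom`); two non-isomorphic quadratic fields always have one
  (`partialConj_of_finrank_eq_two`, recovering `LefQuadMixed` through `LefPartialConj`).
* **Normal-partner criterion** (`partialConj_iff_not_le_of_normal`): for `K₂` NORMAL over `ℚ` whose non-generators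
  are totally real (`NonGenReal K₂` — imaginary quadratic fields, cyclic quartic CM fields; a per-field checkable
  hypothesis, no Galois group is computed) and carrying a CM type, `PartialConj K₁ K₂ ↔ ¬ galClosure K₂ ≤ galClosure K₁`,
  i.e. iff one (any) embedding of `K₂` has a value outside `galClosure K₁` (`partialConj_iff_exists_not_mem_of_normal`).
* **Exclusive-partner criterion** (`partialConj_iff_ne`): call `K` closure-exclusive (`ClosureExclusive K`) when every
  element of its Galois closure `L` is real or has conjugates generating `L` (no proper non-real normal subfield;
  proved for the normal `NonGenReal` fields, `closureExclusive_of_normal`; true for `D₄` quartic CM fields — not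
  formalised here). For two closure-exclusive fields carrying CM types, `PartialConj K₁ K₂ ↔ galClosure K₁ ≠ galClosure K₂`:
  the reflex-sister dichotomy of `LefPartialConj` in closed form.
* Model headlines: `lef_hc_prod_of_presented_of_inf_eq_bot`, `lef_hc_prodFin_cmObj_of_inf_eq_bot`,
  `lef_hc_prod_of_presented_of_normal`, `lef_hc_prod_of_presented_of_ne`, … — `LefPartialConj`'s theorems with `PartialConj K₁ K₂`
  replaced by the field-theoretic ones.

What is NOT here: `ClosureExclusive K` for a `D₄` quartic CM field `K` (every nontrivial normal subgroup of `D₄`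
contains the centre) — the one input that would make `partialConj_iff_ne` unconditional for all pairs of
non-biquadratic quartic CM fields; it is a statement about `D₄` and is not formalised in this file.

Nothing is cited: kernel facts (Mathlib's infinite Galois theory applied to `ℚ̄ = algebraicClosure ℚ ℂ`).
-/

noncomputable section

set_option backward.isDefEq.respectTransparency false

namespace HodgeCM.Toy

open scoped TensorProduct
open exteriorPower Module CMPresentation CMTypeOps
open NumberField.ComplexEmbedding (conjugate)
open Literature.AlgebraicGeometry.Motives

/-! ### 6. Model headlines: `LefPartialConj` with the hypothesis discharged -/

section Headline

variable (K₁ K₂ : CMField)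

/-- two CM fields of degree `≤ 4` whose Galois closures meet in `ℚ` are compatible in the Lefschetz model -/
theorem compatible_of_inf_eq_bot (h : galClosure K₁ ⊓ galClosure K₂ = ⊥) : Obj.Compatible K₁ K₂ :=
  Or.inr (Or.inr (partialConj_of_inf_eq_bot h))

/-- two CM fields whose Galois closures meet in a field of ODD degree are compatible in the
Lefschetz model -/
theorem compatible_of_odd_finrank (h : Odd (Module.finrank ℚ ↥(galClosure K₁ ⊓ galClosure K₂))) :
    Obj.Compatible K₁ K₂ :=
  Or.inr (Or.inr (partialConj_of_odd_finrank h))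

/-- **HEADLINE.** `A_{(K₁,Φ₀)} × ⋯ × A_{(K₂,Φ'₀)} × ⋯`: products of CM abelian varieties over two CM fields of
degree `≤ 4` whose Galois closures inside `ℚ̄` meet in `ℚ` satisfy HC in `lefModel`. -/
theorem lef_hc_prod_of_presented_of_inf_eq_bot (h₁ : Module.finrank ℚ K₁ ≤ 4)
    (h₂ : Module.finrank ℚ K₂ ≤ 4) (h : galClosure K₁ ⊓ galClosure K₂ = ⊥) {X Y : Obj} (hX : X.Presented K₁)
    (hY : Y.Presented K₂) : lefModel.HC (X.prod Y) :=
  lef_hc_prod_of_presented_of_presented K₁ K₂ h₁ h₂ (partialConj_of_inf_eq_bot h) hX hY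

/-- … or in a field of odd degree -/
theorem lef_hc_prod_of_presented_of_odd_finrank (h₁ : Module.finrank ℚ K₁ ≤ 4)
    (h₂ : Module.finrank ℚ K₂ ≤ 4) (h : Odd (Module.finrank ℚ ↥(galClosure K₁ ⊓ galClosure K₂))) {X Y : Obj}
    (hX : X.Presented K₁) (hY : Y.Presented K₂) : lefModel.HC (X.prod Y) :=
  lef_hc_prod_of_presented_of_presented K₁ K₂ h₁ h₂ (partialConj_of_odd_finrank h) hX hY

/-- e.g. `A_{(K₁,Φ)} × A_{(K₂,Φ')}` -/
theorem lef_hc_cmObj_prod_cmObj_of_inf_eq_bot (h₁ : Module.finrank ℚ K₁ ≤ 4) (h₂ : Module.finrank ℚ K₂ ≤ 4)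
    (h : galClosure K₁ ⊓ galClosure K₂ = ⊥) (Φ : CMType K₁) (Φ' : CMType K₂) :
    lefModel.HC ((cmObj K₁ Φ).prod (cmObj K₂ Φ')) :=
  lef_hc_cmObj_prod_cmObj K₁ K₂ h₁ h₂ (partialConj_of_inf_eq_bot h) Φ Φ'

/-- **HEADLINE (family form).** CM fields `Ks a` of degree `≤ 4` whose Galois closures PAIRWISE meet in `ℚ`:
every product `A_{(Ks (c 0), Θ₀)} × ⋯ × A_{(Ks (c n), Θₙ)}` satisfies HC in `lefModel`. -/
theorem lef_hc_prodFin_cmObj_of_inf_eq_bot {ι : Type} (Ks : ι → CMField)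
    (hd : ∀ a, Module.finrank ℚ (Ks a) ≤ 4) (h : ∀ a b, a ≠ b → galClosure (Ks a) ⊓ galClosure (Ks b) = ⊥)
    {n : ℕ} (c : Fin (n + 1) → ι) (Θ : ∀ j, CMType (Ks (c j))) :
    lefModel.HC (lefModel.prodFin n fun j => cmObj (Ks (c j)) (Θ j)) :=
  lef_hc_prodFin_cmObj_multi Ks hd (fun a b hab => partialConj_of_inf_eq_bot (h a b hab)) c Θ

/-- the NEGATIVE reading of the criterion for the model: if the Galois closure of `K₂` lies inside that of `K₁`
(reflex sisters), `LefPartialConj` does not apply — `PartialConj K₁ K₂` is refuted, not merely unproved. -/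
theorem not_partialConj_of_galClosure_le_cm (h : galClosure K₂ ≤ galClosure K₁) (Φ' : CMType K₂) :
    ¬ PartialConj K₁ K₂ :=
  not_partialConj_of_galClosure_le h Φ'

end Headline

/-! ### 7. Normal partners whose non-generators are totally real (imaginary quadratic, cyclic quartic CM, …) -/

section NormalPartner

variable (K : Type) [Field K] [NumberField K]

/-- every element of `K` either generates `K` over `ℚ` or is totally real. Holds for imaginary quadratic fields
(`nonGenReal_of_finrank_eq_two`), cyclic quartic CM fields (their only proper subfield `≠ ℚ` is `K⁺`), cyclic CM
fields of `2`-power degree; FAILS for biquadratic fields and for cyclic sextic CM fields (imaginary quadratic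
subfield). A transparent, per-field checkable hypothesis — no Galois group is computed. -/
def NonGenReal : Prop :=
  ∀ y : K, IntermediateField.adjoin ℚ {y} ≠ ⊤ → ∀ b : K →+* ℂ, starRingEnd ℂ (b y) = b y

/-- quadratic fields: a non-generator is rational -/
theorem nonGenReal_of_finrank_eq_two (hK : Module.finrank ℚ K = 2) : NonGenReal K := by
  intro y hy b
  have hd : Module.finrank ℚ ↥(IntermediateField.adjoin ℚ {y}) ∣ 2 := by
    rw [← hK, ← IntermediateField.finrank_top' (F := ℚ) (E := K)]
    exact IntermediateField.finrank_dvd_of_le_right le_top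
  rcases (Nat.dvd_prime Nat.prime_two).mp hd with h | h
  · rw [IntermediateField.finrank_eq_one_iff] at h
    have hy' : y ∈ (⊥ : IntermediateField ℚ K) := h ▸ IntermediateField.mem_adjoin_simple_self ℚ y
    rw [IntermediateField.mem_bot] at hy'
    obtain ⟨q, rfl⟩ := hy'
    simp
  · exact absurd (IntermediateField.eq_of_le_of_finrank_eq le_top
      (h.trans ((IntermediateField.finrank_top' (F := ℚ) (E := K)).trans hK).symm)) hy

/-- the image of a generator generates the image -/
theorem fieldRange_liftA_eq_adjoin (a : K →+* ℂ) (y : K) (hy : IntermediateField.adjoin ℚ {y} = ⊤) :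
    (liftA K a).fieldRange = IntermediateField.adjoin ℚ {liftK a y} := by
  rw [AlgHom.fieldRange_eq_map, ← hy, IntermediateField.adjoin_map, Set.image_singleton, liftA_apply]

variable {K}
variable {K₁ K₂ : Type} [Field K₁] [NumberField K₁] [Field K₂] [NumberField K₂]

/-- `galClosure K₂ ≤ galClosure K₁` says: every embedding of `K₂` takes values in the Galois closure of `K₁` -/
theorem galClosure_le_iff :
    galClosure K₂ ≤ galClosure K₁ ↔ ∀ b : K₂ →+* ℂ, ∀ y : K₂, liftK b y ∈ galClosure K₁ := by
  constructor
  · exact fun h b y => h (liftK_mem_galClosure K₂ b y)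
  · intro h
    rw [galClosure_eq K₂, iSup_le_iff]
    intro f
    obtain ⟨b, rfl⟩ := exists_liftA_eq K₂ f
    rintro _ ⟨y, rfl⟩
    exact h b y

/-- for NORMAL `K₂` one embedding suffices -/
theorem galClosure_le_iff_of_normal [Normal ℚ K₂] (b : K₂ →+* ℂ) :
    galClosure K₂ ≤ galClosure K₁ ↔ ∀ y : K₂, liftK b y ∈ galClosure K₁ := by
  rw [galClosure_eq_fieldRange K₂ b]
  exact ⟨fun h y => h ⟨y, rfl⟩, fun h => by rintro _ ⟨y, rfl⟩; exact h y⟩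

/-- **Normal-partner criterion (sufficiency).** `K₂` normal over `ℚ` with `NonGenReal K₂`, and `K₂` does not
embed into the Galois closure of `K₁`: then `PartialConj K₁ K₂`. (Elements of `L₁ ∩ L₂ = L₁ ∩ b(K₂)` are images
`b y`; a generator `y` would put `b(K₂) = ℚ(b y)` inside `L₁`; a non-generator is real.) -/
theorem partialConj_of_normal [Normal ℚ K₂] (hK₂ : NonGenReal K₂) (h : ¬ galClosure K₂ ≤ galClosure K₁) :
    PartialConj K₁ K₂ := by
  obtain ⟨b⟩ := (inferInstance : Nonempty (K₂ →+* ℂ))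
  rw [partialConj_iff_conj_eq]
  intro x hx₁ hx₂
  rw [galClosure_eq_fieldRange K₂ b] at hx₂ h
  obtain ⟨y, rfl⟩ := hx₂
  by_cases hy : IntermediateField.adjoin ℚ {y} = ⊤
  · refine absurd ?_ h
    rw [fieldRange_liftA_eq_adjoin K₂ b y hy, IntermediateField.adjoin_simple_le_iff]
    exact hx₁
  · exact hK₂ y hy b

/-- **Normal-partner criterion (iff form)** for `K₂` carrying a CM type: a partial conjugation exists iff `K₂` does
not embed into the Galois closure of `K₁`. Covers: `K₂` imaginary quadratic (any `K₁`), `K₂` cyclic quartic CM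
(any `K₁`: in particular two cyclic quartic CM fields with different images, or a cyclic one against a `D₄` one). -/
theorem partialConj_iff_not_le_of_normal [Normal ℚ K₂] (hK₂ : NonGenReal K₂) (Ψ : CMType K₂) :
    PartialConj K₁ K₂ ↔ ¬ galClosure K₂ ≤ galClosure K₁ :=
  ⟨fun hc hle => not_partialConj_of_galClosure_le hle Ψ hc, partialConj_of_normal hK₂⟩

/-- the same with the embedding condition spelled out on one embedding `b` -/
theorem partialConj_iff_exists_not_mem_of_normal [Normal ℚ K₂] (hK₂ : NonGenReal K₂) (Ψ : CMType K₂)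
    (b : K₂ →+* ℂ) : PartialConj K₁ K₂ ↔ ∃ y : K₂, liftK b y ∉ galClosure K₁ := by
  rw [partialConj_iff_not_le_of_normal hK₂ Ψ, galClosure_le_iff_of_normal b, not_forall]

/-- imaginary quadratic partner: `PartialConj K₁ K₂` iff `K₂` does not embed into the Galois closure of `K₁`
(e.g. `K₁ = ℚ(ζ₅)`, `K₂ = ℚ(i)`: `i ∉ ℚ(ζ₅)`; but `K₂ = ℚ(√-5)`? `√5 ∈ ℚ(ζ₅)`, `i ∉`, so `√-5 ∉ ℚ(ζ₅)` ✓) -/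
theorem partialConj_iff_of_finrank_eq_two (h₂ : Module.finrank ℚ K₂ = 2) (Ψ : CMType K₂) (b : K₂ →+* ℂ) :
    PartialConj K₁ K₂ ↔ ∃ y : K₂, liftK b y ∉ galClosure K₁ :=
  haveI := normal_of_finrank_eq_two K₂ h₂
  partialConj_iff_exists_not_mem_of_normal (nonGenReal_of_finrank_eq_two K₂ h₂) Ψ b

end NormalPartner

section HeadlineNormal

variable (K₁ K₂ : CMField)

/-- **HEADLINE (normal partner).** `K₂` a normal CM field of degree `≤ 4` with `NonGenReal K₂` (imaginary
quadratic or cyclic quartic CM) not embedding into the Galois closure of the CM field `K₁` of degree `≤ 4`: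
every product of CM abelian varieties presented over `K₁` with ones presented over `K₂` satisfies HC in
`lefModel`. -/
theorem lef_hc_prod_of_presented_of_normal [Normal ℚ K₂] (hK₂ : NonGenReal K₂)
    (h : ¬ galClosure K₂ ≤ galClosure K₁) (h₁ : Module.finrank ℚ K₁ ≤ 4) (h₂ : Module.finrank ℚ K₂ ≤ 4)
    {X Y : Obj} (hX : X.Presented K₁) (hY : Y.Presented K₂) : lefModel.HC (X.prod Y) :=
  lef_hc_prod_of_presented_of_presented K₁ K₂ h₁ h₂ (partialConj_of_normal hK₂ h) hX hY

/-- `cmObj K₁ Φ × cmObj K₂ Φ'` satisfies HC in `lefModel` for `K₂` normal with `NonGenReal K₂`,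
`galClosure K₂ ⊄ galClosure K₁`, both degrees `≤ 4` (any CM types) -/
theorem lef_hc_cmObj_prod_cmObj_of_normal [Normal ℚ K₂] (hK₂ : NonGenReal K₂)
    (h : ¬ galClosure K₂ ≤ galClosure K₁) (h₁ : Module.finrank ℚ K₁ ≤ 4) (h₂ : Module.finrank ℚ K₂ ≤ 4)
    (Φ : CMType K₁) (Φ' : CMType K₂) : lefModel.HC ((cmObj K₁ Φ).prod (cmObj K₂ Φ')) :=
  lef_hc_cmObj_prod_cmObj K₁ K₂ h₁ h₂ (partialConj_of_normal hK₂ h) Φ Φ'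

end HeadlineNormal

/-! ### 8. Closure-exclusive fields: a partial conjugation exists iff the Galois closures differ -/

section ClosureExclusive

variable (K : Type) [Field K] [NumberField K]

/-- every element of the Galois closure `L ⊆ ℚ̄` of `K` is real, or its conjugates generate `L` — i.e. `L` has no
proper normal subfield that is not real (group-theoretically: every nontrivial normal subgroup of `Gal(L/ℚ)`
contains complex conjugation). PROVED here for normal fields with `NonGenReal` (imaginary quadratic, cyclic quartic
CM: `closureExclusive_of_normal`); TRUE for `D₄` quartic CM fields (every nontrivial normal subgroup of `D₄` contains
the centre `⟨c⟩`) — that instance is NOT formalised in this file and is the one remaining input for the `D₄ × D₄`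
case; FALSE for biquadratic fields and cyclic sextic CM fields. -/
def ClosureExclusive : Prop :=
  ∀ x ∈ galClosure K, Obj.kap x = x ∨ galClosure K ≤ IntermediateField.normalClosure ℚ ↥(IntermediateField.adjoin ℚ {x}) Qbar

/-- a NORMAL number field whose non-generators are totally real (`NonGenReal`) is
closure-exclusive -/
theorem closureExclusive_of_normal [Normal ℚ K] (hK : NonGenReal K) : ClosureExclusive K := by
  obtain ⟨b⟩ := (inferInstance : Nonempty (K →+* ℂ))
  intro x hx
  rw [galClosure_eq_fieldRange K b] at hx ⊢
  obtain ⟨y, rfl⟩ := hx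
  by_cases hy : IntermediateField.adjoin ℚ {y} = ⊤
  · right
    rw [fieldRange_liftA_eq_adjoin K b y hy]
    exact IntermediateField.le_normalClosure _
  · left
    exact (kap_apply_eq_self_iff _).mpr (hK y hy b)

/-- quadratic number fields are closure-exclusive -/
theorem closureExclusive_of_finrank_eq_two (hK : Module.finrank ℚ K = 2) : ClosureExclusive K :=
  haveI := normal_of_finrank_eq_two K hK
  closureExclusive_of_normal K (nonGenReal_of_finrank_eq_two K hK)

variable {K}
variable {K₁ K₂ : Type} [Field K₁] [NumberField K₁] [Field K₂] [NumberField K₂]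

/-- **Exclusive-partner criterion (sufficiency).** -/
theorem partialConj_of_closureExclusive (h₂ : ClosureExclusive K₂) (h : ¬ galClosure K₂ ≤ galClosure K₁) :
    PartialConj K₁ K₂ := by
  rw [partialConj_iff]
  intro x hx₁ hx₂
  rcases h₂ x hx₂ with hx | hle
  · exact hx
  · refine absurd (hle.trans ?_) h
    calc IntermediateField.normalClosure ℚ ↥(IntermediateField.adjoin ℚ {x}) Qbar
          ≤ IntermediateField.normalClosure ℚ ↥(galClosure K₁) Qbar :=
          IntermediateField.normalClosure_mono _ _ (IntermediateField.adjoin_simple_le_iff.mpr hx₁)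
      _ = galClosure K₁ := IntermediateField.normalClosure_of_normal _

/-- **Exclusive-partner criterion (iff).** For `K₂` closure-exclusive carrying a CM type: a partial conjugation
exists iff the Galois closure of `K₂` is not inside that of `K₁`. -/
theorem partialConj_iff_not_le_of_closureExclusive (h₂ : ClosureExclusive K₂) (Ψ : CMType K₂) :
    PartialConj K₁ K₂ ↔ ¬ galClosure K₂ ≤ galClosure K₁ :=
  ⟨fun hc hle => not_partialConj_of_galClosure_le hle Ψ hc, partialConj_of_closureExclusive h₂⟩

/-- **Both fields closure-exclusive: a partial conjugation exists as soon as the Galois closures DIFFER** … -/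
theorem partialConj_of_ne (h₁ : ClosureExclusive K₁) (h₂ : ClosureExclusive K₂)
    (hne : galClosure K₁ ≠ galClosure K₂) : PartialConj K₁ K₂ := by
  by_cases hle : galClosure K₂ ≤ galClosure K₁
  · exact (partialConj_of_closureExclusive h₁ fun hle' => hne (le_antisymm hle' hle)).symm
  · exact partialConj_of_closureExclusive h₂ hle

/-- … **and only then** (`K₂` carrying a CM type): the reflex-sister dichotomy of `LefPartialConj` in closed form —
same closure (a field and its `D₄` reflex sister, or isomorphic fields) ⇒ no partial conjugation; different
closures ⇒ one exists. -/
theorem partialConj_iff_ne (h₁ : ClosureExclusive K₁) (h₂ : ClosureExclusive K₂) (Ψ₂ : CMType K₂) :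
    PartialConj K₁ K₂ ↔ galClosure K₁ ≠ galClosure K₂ :=
  ⟨fun hc he => not_partialConj_of_galClosure_le he.ge Ψ₂ hc, partialConj_of_ne h₁ h₂⟩

end ClosureExclusive

section HeadlineExclusive

variable (K₁ K₂ : CMField)

/-- **HEADLINE (closure-exclusive pair).** Two closure-exclusive CM fields of degree `≤ 4` (imaginary quadratic,
cyclic quartic CM — and `D₄` quartic CM once `ClosureExclusive` is verified for them) with DIFFERENT Galois closures
in `ℚ̄`: every product of CM abelian varieties presented over `K₁` with ones presented over `K₂` satisfies HC in
`lefModel`. -/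
theorem lef_hc_prod_of_presented_of_ne (e₁ : ClosureExclusive K₁) (e₂ : ClosureExclusive K₂)
    (hne : galClosure K₁ ≠ galClosure K₂) (h₁ : Module.finrank ℚ K₁ ≤ 4) (h₂ : Module.finrank ℚ K₂ ≤ 4)
    {X Y : Obj} (hX : X.Presented K₁) (hY : Y.Presented K₂) : lefModel.HC (X.prod Y) :=
  lef_hc_prod_of_presented_of_presented K₁ K₂ h₁ h₂ (partialConj_of_ne e₁ e₂ hne) hX hY

/-- `cmObj K₁ Φ × cmObj K₂ Φ'` satisfies HC in `lefModel` for two closure-exclusive CM fields of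
degree `≤ 4` with different Galois closures (any CM types) -/
theorem lef_hc_cmObj_prod_cmObj_of_ne (e₁ : ClosureExclusive K₁) (e₂ : ClosureExclusive K₂)
    (hne : galClosure K₁ ≠ galClosure K₂) (h₁ : Module.finrank ℚ K₁ ≤ 4) (h₂ : Module.finrank ℚ K₂ ≤ 4)
    (Φ : CMType K₁) (Φ' : CMType K₂) : lefModel.HC ((cmObj K₁ Φ).prod (cmObj K₂ Φ')) :=
  lef_hc_cmObj_prod_cmObj K₁ K₂ h₁ h₂ (partialConj_of_ne e₁ e₂ hne) Φ Φ'

/-- family form: pairwise different closures of closure-exclusive CM fields of degree `≤ 4` -/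
theorem lef_hc_prodFin_cmObj_of_ne {ι : Type} (Ks : ι → CMField) (hd : ∀ a, Module.finrank ℚ (Ks a) ≤ 4)
    (he : ∀ a, ClosureExclusive (Ks a)) (h : ∀ a b, a ≠ b → galClosure (Ks a) ≠ galClosure (Ks b))
    {n : ℕ} (c : Fin (n + 1) → ι) (Θ : ∀ j, CMType (Ks (c j))) :
    lefModel.HC (lefModel.prodFin n fun j => cmObj (Ks (c j)) (Θ j)) :=
  lef_hc_prodFin_cmObj_multi Ks hd (fun a b hab => partialConj_of_ne (he a) (he b) (h a b hab)) c Θ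

end HeadlineExclusive

end HodgeCM.Toy

end
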